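/-
Copyright (c) 2026 the pub-hodgecm-mathlib formalisation cell (harness21).  Prover seat hodgecm-mathlib-K2Liu-p13 (g4), Track B «K2-LIT»,
#184♮ = hLiu418 = `stmt-HodgeConjecture-24832`; ROAD Φ (RULING «M-156n»), #41 TOP — the scalar letter `haR` of ★∕📤 `K2LiuBigCellEulerFaceAssembly.eulerFace_of_letters`:
once (E4)∕(F-GK-4) identifies each spherical local factor of ★ (E3)'s tail `∏'_{v∉T} ∫ Λ_{s,v}((w_Δ)_v y) dν_v` with the Gindikin–Karpelevich scalar `c_v(s)` (POINTWISE, by value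
here), the tail IS `a^T∕b^T` (★ O41.6 `hasProd_localScalar`) and the TOP's scalar `b^S∕a^S` times the tail is the finite correction `∏_{v∈P} c_v⁻¹`, `T = S ∪ P` (★ p861784).
THEOREMS ONLY (no `def`, no `instance`, no named-fact hypothesis, no `sorry`).
-/
import Summits.HodgeConjecture.HodgeConjecture.Theorems.K2LiuSiegelIntertwiningScalarChangeOfSet   -- ★ p861784 (`invScalar_mul_scalar_union_eq_finsetProd`) + ★ O41.6
import HarnessLib

/-!
# Crux `HLiu418`, ROAD Φ, organ Φ8 (row G6): THE TAIL OF THE EULER HEAD IS `a^T∕b^T`, AND `(b^S∕a^S)·tail = ∏_{v∈P} c_v⁻¹`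

Cell `hodgecm-mathlib`, crux item hLiu418 = `stmt-HodgeConjecture-24832` (helper lane, count-neutral).  Number field `F`, unitary `ε`, `re s > 1`.
* **`tprod_eq_scalar_of_forall_eq`** — if a family `I : {v ∉ S} → ℂ` agrees pointwise with the local scalars `c_v(s)` then `∏' I = a^S(s)∕b^S(s)` (★ `hasProd_localScalar`).
* **`invScalar_mul_tprod_eq_finsetProd`** — for `P` finite disjoint from `S` and `I : {v ∉ S ∪ P} → ℂ` pointwise `= c_v(s)`: `(b^S∕a^S)(s) · ∏' I = ∏_{v∈P} c_v(s)⁻¹`.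
* the CM forms `…_cm` (`ε = ε_{L∕L⁺}`, `F = L⁺`).
With `I v := ∫ Λ_{s,v}((w_Δ)_v y) dν_v` (★ E3's tail at `T = S_ε.toFinset ∪ P`) and the pointwise identity from (F-GK-4), this is the letter `haR` of the END-file skeleton, `corr = ∏_{v∈P} c_v⁻¹`.
Sources: [Tan1999, §3]; [Harris2007, (1.3.4) p. 92]; [KudlaSweet1997, §1]; [Liu2011, §2A (2-2)].
HONEST LABEL.  Helper lemmas, count-neutral; `HC_CM` is proved only modulo the 7 printed citations (2 remaining named inputs:
hLiu418 = `stmt-HodgeConjecture-24832`, h413 = `stmt-HodgeConjecture-24833`) until rung 0 closes.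
-/

set_option autoImplicit false
set_option linter.dupNamespace false -- the mandated namespace repeats `HodgeConjecture.HodgeConjecture`

noncomputable section

open scoped NNReal
open Filter Topology Complex NumberField IsDedekindDomain
open Literature.NumberTheory.Automorphic Literature.NumberTheory.LFunctions Literature.NumberTheory.GaloisRepresentations

namespace Summit.HodgeConjecture.HodgeConjecture.Cruxes.HLiu418.K2LiuBigCellTailScalar

open Summit.HodgeConjecture.HodgeConjecture.Cruxes.HLiu418.K2LiuSiegelIntertwiningScalarGL1
open Summit.HodgeConjecture.HodgeConjecture.Cruxes.HLiu418.K2LiuSiegelIntertwiningScalarChangeOfSet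

section GL1

variable {F : Type} [Field F] [NumberField F] {ε : HeckeCharacter F}

/-- **THE TAIL IS `a^S∕b^S`**: a family over the places off `S` that agrees pointwise with the local Gindikin–Karpelevich scalars has `∏'` equal to `a^S(s)∕b^S(s)` (`re s > 1`).
[cite: Harris2007, (1.3.4) p. 92] [cite: Liu2011, §2A (2-2)] -/
theorem tprod_eq_scalar_of_forall_eq (hε : ε.IsUnitary) (S : Set (HeightOneSpectrum (𝓞 F))) {s : ℂ} (hs : 1 < s.re)
    (I : {v : HeightOneSpectrum (𝓞 F) // v ∉ S} → ℂ)
    (hI : ∀ v : {v : HeightOneSpectrum (𝓞 F) // v ∉ S},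
      I v = ((1 - (v.1.residueCard : ℂ) ^ (-(2 * s + 1))) * (1 - ε.valueAtUniformizer v.1 * (v.1.residueCard : ℂ) ^ (-(2 * s + 2)))) /
        ((1 - (v.1.residueCard : ℂ) ^ (-(2 * s))) * (1 - ε.valueAtUniformizer v.1 * (v.1.residueCard : ℂ) ^ (-(2 * s - 1))))) :
    ∏' v : {v : HeightOneSpectrum (𝓞 F) // v ∉ S}, I v =
      (partialStandardL S (fun _ => {1}) (2 * s) * partialStandardL S (fun v => {ε.valueAtUniformizer v}) (2 * s - 1)) /
        (partialStandardL S (fun _ => {1}) (2 * s + 1) * partialStandardL S (fun v => {ε.valueAtUniformizer v}) (2 * s + 2)) := by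
  rw [show I = fun v : {v : HeightOneSpectrum (𝓞 F) // v ∉ S} =>
      ((1 - (v.1.residueCard : ℂ) ^ (-(2 * s + 1))) * (1 - ε.valueAtUniformizer v.1 * (v.1.residueCard : ℂ) ^ (-(2 * s + 2)))) /
        ((1 - (v.1.residueCard : ℂ) ^ (-(2 * s))) * (1 - ε.valueAtUniformizer v.1 * (v.1.residueCard : ℂ) ^ (-(2 * s - 1)))) from funext hI]
  exact (hasProd_localScalar (S := S) hε hs).tprod_eq

/-- **`(b^S∕a^S)(s) · ∏'_{v∉S∪P} I_v = ∏_{v∈P} c_v(s)⁻¹`** for `P` finite disjoint from `S` and `I` pointwise the local scalar off `S ∪ P` (`re s > 1`; ★ p861784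
`invScalar_mul_scalar_union_eq_finsetProd`). [cite: Tan1999, §3] [cite: KudlaSweet1997, §1] -/
theorem invScalar_mul_tprod_eq_finsetProd (hε : ε.IsUnitary) (S : Set (HeightOneSpectrum (𝓞 F))) (P : Finset (HeightOneSpectrum (𝓞 F)))
    (hPS : ∀ v ∈ P, v ∉ S) {s : ℂ} (hs : 1 < s.re)
    (I : {v : HeightOneSpectrum (𝓞 F) // v ∉ S ∪ (↑P : Set (HeightOneSpectrum (𝓞 F)))} → ℂ)
    (hI : ∀ v : {v : HeightOneSpectrum (𝓞 F) // v ∉ S ∪ (↑P : Set (HeightOneSpectrum (𝓞 F)))},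
      I v = ((1 - (v.1.residueCard : ℂ) ^ (-(2 * s + 1))) * (1 - ε.valueAtUniformizer v.1 * (v.1.residueCard : ℂ) ^ (-(2 * s + 2)))) /
        ((1 - (v.1.residueCard : ℂ) ^ (-(2 * s))) * (1 - ε.valueAtUniformizer v.1 * (v.1.residueCard : ℂ) ^ (-(2 * s - 1))))) :
    (partialStandardL S (fun _ => {1}) (2 * s + 1) * partialStandardL S (fun v => {ε.valueAtUniformizer v}) (2 * s + 2)) /
          (partialStandardL S (fun _ => {1}) (2 * s) * partialStandardL S (fun v => {ε.valueAtUniformizer v}) (2 * s - 1)) *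
        ∏' v : {v : HeightOneSpectrum (𝓞 F) // v ∉ S ∪ (↑P : Set (HeightOneSpectrum (𝓞 F)))}, I v =
      ∏ v ∈ P, (((1 - (v.residueCard : ℂ) ^ (-(2 * s))) * (1 - ε.valueAtUniformizer v * (v.residueCard : ℂ) ^ (-(2 * s - 1)))) /
          ((1 - (v.residueCard : ℂ) ^ (-(2 * s + 1))) * (1 - ε.valueAtUniformizer v * (v.residueCard : ℂ) ^ (-(2 * s + 2))))) := by
  rw [tprod_eq_scalar_of_forall_eq hε (S ∪ (↑P : Set (HeightOneSpectrum (𝓞 F)))) hs I hI]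
  exact invScalar_mul_scalar_union_eq_finsetProd hε S P hPS hs

end GL1

/-! ## The CM forms -/

section CM

variable (L : Type) [Field L] [NumberField L] [IsCMField L]

/-- **AT THE K2_Liu FRAME** (`ε = ε_{L∕L⁺}`): `(b^S∕a^S)(s) · ∏'_{v∉S∪P} I_v = ∏_{v∈P} c_v(s)⁻¹` when `I` is pointwise the local scalar — the letter `haR` of
★∕📤 `K2LiuBigCellEulerFaceAssembly.eulerFace_of_letters` with `corr = ∏_{v∈P} c_v⁻¹`. [cite: Tan1999, §3] [cite: Harris2007, (1.3.4) p. 92] -/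
theorem invScalar_mul_tprod_eq_finsetProd_cm (S : Set (HeightOneSpectrum (𝓞 ↥(maximalRealSubfield L))))
    (P : Finset (HeightOneSpectrum (𝓞 ↥(maximalRealSubfield L)))) (hPS : ∀ v ∈ P, v ∉ S) {s : ℂ} (hs : 1 < s.re)
    (I : {v : HeightOneSpectrum (𝓞 ↥(maximalRealSubfield L)) // v ∉ S ∪ (↑P : Set (HeightOneSpectrum (𝓞 ↥(maximalRealSubfield L))))} → ℂ)
    (hI : ∀ v : {v : HeightOneSpectrum (𝓞 ↥(maximalRealSubfield L)) // v ∉ S ∪ (↑P : Set (HeightOneSpectrum (𝓞 ↥(maximalRealSubfield L))))},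
      I v = ((1 - (v.1.residueCard : ℂ) ^ (-(2 * s + 1))) * (1 - (quadraticHeckeCharCM L).valueAtUniformizer v.1 * (v.1.residueCard : ℂ) ^ (-(2 * s + 2)))) /
        ((1 - (v.1.residueCard : ℂ) ^ (-(2 * s))) * (1 - (quadraticHeckeCharCM L).valueAtUniformizer v.1 * (v.1.residueCard : ℂ) ^ (-(2 * s - 1))))) :
    (partialStandardL S (fun _ => {1}) (2 * s + 1) * partialStandardL S (fun v => {(quadraticHeckeCharCM L).valueAtUniformizer v}) (2 * s + 2)) /
          (partialStandardL S (fun _ => {1}) (2 * s) * partialStandardL S (fun v => {(quadraticHeckeCharCM L).valueAtUniformizer v}) (2 * s - 1)) *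
        ∏' v : {v : HeightOneSpectrum (𝓞 ↥(maximalRealSubfield L)) // v ∉ S ∪ (↑P : Set (HeightOneSpectrum (𝓞 ↥(maximalRealSubfield L))))}, I v =
      ∏ v ∈ P, (((1 - (v.residueCard : ℂ) ^ (-(2 * s))) * (1 - (quadraticHeckeCharCM L).valueAtUniformizer v * (v.residueCard : ℂ) ^ (-(2 * s - 1)))) /
          ((1 - (v.residueCard : ℂ) ^ (-(2 * s + 1))) * (1 - (quadraticHeckeCharCM L).valueAtUniformizer v * (v.residueCard : ℂ) ^ (-(2 * s + 2))))) :=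
  invScalar_mul_tprod_eq_finsetProd (Literature.RepresentationTheory.HarrisKudlaSweet1996.isFiniteOrder_quadraticHeckeCharCM (L := L)).isUnitary S P hPS hs I hI

end CM

end Summit.HodgeConjecture.HodgeConjecture.Cruxes.HLiu418.K2LiuBigCellTailScalar

end
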